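import Mathlib.RepresentationTheory.Invariants
import Mathlib.LinearAlgebra.Projection
import Mathlib.Algebra.Module.Projective
import Mathlib.RingTheory.Ideal.Operations
import HarnessLib

/-!
# Exceptional-zero road at `p = 3`, audit brick V-B6′ (the quaternionic ordinary family, BD07 Thm. 2.5,
# at `p = 3`): the characteristic-`0` DESCENT LEMMA — finite-group invariants commute with base change
# and with exact control when the group order is invertible (cell `bsd-stepL`, seat `bsd-stepL-mult-p4`
# g4; `--supports stmt-BirchSwinnertonDyer-19109`, helper)

Cell `bsd-stepL` (D-0131 (3) middle tier, seat `bsd-stepL-mult-p4`, lens «split-multiplicative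
`r = 1` via the 𝓛-invariant `p`-adic Gross–Zagier + Kobayashi 2006»). PURE ALGEBRA, unconditional;
no definition, no named fact, no `sorry`; nothing about any curve is asserted (TARGET T7).

## Why (memo `HOME/mult-p4/EXZ-ROAD-MEMO-g4.md` §2, brick V-B6′)

The exceptional display «conj@3-with-m» (Disegni 2020 Thm. 4, second bullet, read at `p = 3`) rests,
through Venerucci 2016 Thm. D ∕ Bertolini–Darmon 2007 Thm. 5.4, on BD07 Thm. 2.5: the ordinary `p`-adic
family `φ_∞` of measure-valued forms on the DEFINITE quaternion algebra `B` of discriminant `m·∞`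
(`m` the second multiplicative prime) at Eichler level `U = Σ₀(pN⁺)`, specialising at every classical
weight `k` of a disc `𝒰 ∋ 2` to a non-zero multiple of the Jacquet–Langlands transfer `φ_k`. BD07's
proof («the proof of Theorem (5.13) of [GS] adapts mutatis mutandis», §2.4) is Hida ∕ Greenberg–Stevens
control for `e·S(U, 𝔻)`, which is combinatorial (`S(U, M) = ⊕_i M^{Γ_i}` over the finite double-coset
set `B^×\B̂^×∕U`, `Γ_i = B^× ∩ x_i U x_i⁻¹` FINITE unit groups of orders dividing `24`) and is exact
integrally as soon as `p ∤ #(Γ_i∕±1)` — automatic for `p ≥ 5`, false in general at `p = 3`. The audit's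
repair: run the integral argument at the auxiliary NEAT level `U″ = U ∩ U(r)` (`r ≥ 5` prime, `r ∤ pN`:
a torsion unit `ζ ≠ ±1` of `B^×` congruent to `1 mod r` would give `r ∣ N(1 − ζ) = Φ_n(1) ∈ {1,2,3}`,
`n ∈ {3,4,6}`), where every `Γ″_i` is trivial and the `p ≥ 5` proof applies verbatim at `p = 3`, and
DESCEND along the finite group `G = U∕U″ ≅ GL₂(𝔽_r)` acting on `S(U″, ·)` by right translation
(`S(U, ·) = S(U″, ·)^G` tautologically) AFTER extending scalars from `Λ` to the `ℚ_p`-affinoid algebra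
`A = A(𝒰)` of the weight disc, where `#G ∈ A^×`. The two facts used about `G`-invariants over such an
`A` are exactly the theorems of this file:

* `invariants_map_eq_of_surjective` — a SURJECTIVE `G`-equivariant `A`-linear map (the weight-`k`
  specialisation `e·S(U″,𝔻)⊗A ↠ e·S(U″,L_k(ℚ_p))`) restricts to a SURJECTION on `G`-invariants
  (`e·S(U,𝔻_A) ↠ e·S(U,L_k(ℚ_p))`): lift, then average;
* `invariants_inf_smul_top` ∕ `invariants_inf_ker_eq_smul` — its kernel on invariants is
  `I_k • (invariants)` when the kernel upstairs is `I_k • (everything)` (exact control descends);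
* `exists_isCompl_invariants` ∕ `projective_invariants` — the invariants are a direct summand (so free
  of finite rank over the PID `A(𝒰)` when the module upstairs is).
With these, BD07's family at level `U` is the rank-one eigen-direct-summand cut out by the Hida
eigenvalues of `f_∞` (non-zero at every classical `k ∈ 𝒰` by Jacquet–Langlands multiplicity one and
Zariski density) — no integrality, no étaleness and no Jacquet–Langlands-in-families input is needed
for the `ℚ^×`-valued statement BD07 Thm. 5.4 (memo §2.3). Everything here is elementary and stated for
an arbitrary commutative ring `A`, finite group `G` with `#G` invertible in `A`, and representations on
arbitrary `A`-modules.

## Results (namespace `…Theorems.ExceptionalZeroRoad.Descent`)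

`map_invariants_le`, `averageMap_apply`, `apply_averageMap` (equivariant maps commute with averaging),
`range_averageMap`, `invariants_map_eq_of_surjective`, `invariants_inf_smul_top`,
`invariants_inf_ker_eq_smul`, `invariants_descent` (the two halves bundled), `exists_isCompl_invariants`,
`projective_invariants`; §2 (direct summands, memo step S5): `range_inf_smul_top_of_isIdempotentElem`,
`inf_smul_top_eq_smul_of_isCompl`, `mem_smul_of_mem_of_mem_smul_top`; §3 (B2 sheet (c3)):
`glTwoFThree_exists_commutators_without_common_eigenvector`, `glTwoFThree_exists_mem_moves_line_of_commutators_mem`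
(the commutator subgroup of `GL₂(𝔽₃)` fixes no line — `decide`).

References: [BertoliniDarmon2007] Thm. 2.5, §2.4, Rem. 2.6; [GreenbergStevens1993] Thm. 5.13,
Prop. 6.1; Buzzard, «On p-adic families of automorphic forms» (Progr. Math. 224, 2004), Part III
(«sufficiently small» level); cell memo HOME/mult-p4/EXZ-ROAD-MEMO-g4.md §2.
-/

set_option autoImplicit false

-- Theorems files of this problem live in `Summit.BirchSwinnertonDyer.BirchSwinnertonDyer.Theorems.*`.
set_option linter.dupNamespace false

namespace Summit.BirchSwinnertonDyer.BirchSwinnertonDyer.Theorems.ExceptionalZeroRoad.Descent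

open Representation

variable {A G M M' : Type*} [CommRing A] [Group G] [AddCommGroup M] [Module A M] [AddCommGroup M']
  [Module A M'] (ρ : Representation A G M) (σ : Representation A G M')

/-- **Equivariant maps send invariants into invariants** (no finiteness needed): if
`f ∘ ρ(g) = σ(g) ∘ f` for all `g`, then `f(M^G) ≤ M′^G`. [cite: BertoliniDarmon2007, §2.4 (level structures)] -/
theorem map_invariants_le (f : M →ₗ[A] M') (hf : ∀ g : G, f ∘ₗ ρ g = σ g ∘ₗ f) :
    ρ.invariants.map f ≤ σ.invariants := by
  rintro _ ⟨v, hv, rfl⟩ g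
  have h := congrArg (fun φ : M →ₗ[A] M' ↦ φ v) (hf g)
  simp only [LinearMap.coe_comp, Function.comp_apply] at h
  rw [← h, (ρ.mem_invariants v).1 hv g]

variable [Fintype G] [Invertible (Fintype.card G : A)]

/-- **The averaging projector, pointwise**: `e_G v = (#G)⁻¹ • ∑_g ρ(g) v`.
[cite: BertoliniDarmon2007, §2.4] -/
theorem averageMap_apply (v : M) :
    ρ.averageMap v = ⅟(Fintype.card G : A) • ∑ g : G, ρ g v := by
  simp [Representation.averageMap, GroupAlgebra.average, map_sum, LinearMap.sum_apply,
    LinearMap.smul_apply]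

/-- **Equivariant maps commute with averaging**: `f(e_G v) = e_G(f v)`.
[cite: BertoliniDarmon2007, §2.4] -/
theorem apply_averageMap (f : M →ₗ[A] M') (hf : ∀ g : G, f ∘ₗ ρ g = σ g ∘ₗ f) (v : M) :
    f (ρ.averageMap v) = σ.averageMap (f v) := by
  rw [averageMap_apply, averageMap_apply, map_smul, map_sum]
  congr 1
  refine Finset.sum_congr rfl fun g _ ↦ ?_
  have h := congrArg (fun φ : M →ₗ[A] M' ↦ φ v) (hf g)
  simpa only [LinearMap.coe_comp, Function.comp_apply] using h

/-- **The image of the averaging projector is exactly the invariants.**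
[cite: BertoliniDarmon2007, §2.4] -/
theorem range_averageMap : LinearMap.range ρ.averageMap = ρ.invariants := by
  refine le_antisymm ?_ fun v hv ↦ ⟨v, ρ.averageMap_id v hv⟩
  rintro _ ⟨v, rfl⟩
  exact ρ.averageMap_invariant v

/-- **Invariants commute with SURJECTIVE equivariant base change when `#G` is invertible**: for a
surjective `G`-equivariant `A`-linear map `f : M ↠ M′`, `M′^G = f(M^G)` — lift an invariant, then
average the lift. (Applied in the audit to the weight-`k` specialisation of ordinary `Λ`-adic forms at a
neat auxiliary level, `G = GL₂(𝔽_r)`, `A` the `ℚ_p`-affinoid algebra of the weight disc.)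
[cite: BertoliniDarmon2007, Thm. 2.5, §2.4] [cite: GreenbergStevens1993, Thm. 5.13 b] -/
theorem invariants_map_eq_of_surjective (f : M →ₗ[A] M') (hf : ∀ g : G, f ∘ₗ ρ g = σ g ∘ₗ f)
    (hsurj : Function.Surjective f) : ρ.invariants.map f = σ.invariants := by
  refine le_antisymm (map_invariants_le ρ σ f hf) fun v' hv' ↦ ?_
  obtain ⟨v, rfl⟩ := hsurj v'
  refine ⟨ρ.averageMap v, ρ.averageMap_invariant v, ?_⟩
  rw [apply_averageMap ρ σ f hf, σ.averageMap_id _ hv']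

/-- **Invariants meet `I•M` in `I•(invariants)`** (`#G` invertible): `M^G ∩ I·M = I·M^G` for every
ideal `I` of `A` — average a presentation `x = ∑ aⱼ mⱼ`, `aⱼ ∈ I`. (In the audit: `I = I_k` the ideal
of the weight-`k` point; the kernel of exact control upstairs is `I_k·(everything)`.)
[cite: BertoliniDarmon2007, Thm. 2.5, §2.4] [cite: GreenbergStevens1993, Prop. 6.1] -/
theorem invariants_inf_smul_top (I : Ideal A) :
    ρ.invariants ⊓ (I • ⊤ : Submodule A M) = I • ρ.invariants := by
  refine le_antisymm ?_ (le_inf Submodule.smul_le_right (Submodule.smul_mono le_rfl le_top))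
  rintro x ⟨hx, hxI⟩
  have hx' : x = ρ.averageMap x := (ρ.averageMap_id x hx).symm
  rw [hx']
  have hmem : ρ.averageMap x ∈ (I • (⊤ : Submodule A M)).map ρ.averageMap := ⟨x, hxI, rfl⟩
  rw [Submodule.map_smul'', Submodule.map_top, range_averageMap] at hmem
  exact hmem

/-- **Exact control descends to invariants (kernel half)**: if the equivariant map `f` has kernel
`I•M`, its restriction to `M^G` has kernel `I•M^G`. [cite: BertoliniDarmon2007, Thm. 2.5, §2.4]
[cite: GreenbergStevens1993, Thm. 5.13 b, Prop. 6.1] -/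
theorem invariants_inf_ker_eq_smul (f : M →ₗ[A] M') (I : Ideal A)
    (hker : LinearMap.ker f = I • (⊤ : Submodule A M)) :
    ρ.invariants ⊓ LinearMap.ker f = I • ρ.invariants := by
  rw [hker, invariants_inf_smul_top]

/-- **DESCENT OF EXACT CONTROL (both halves)**: for a surjective `G`-equivariant `A`-linear `f : M ↠ M′`
with kernel `I•M` and `#G ∈ A^×`, the restriction `M^G → M′^G` is surjective with kernel `I•M^G` — i.e.
`M^G ∕ I·M^G ≅ M′^G`. This is the statement used for V-B6′: exact control of ordinary `Λ ⊗ A(𝒰)`-adic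
quaternionic forms at the neat auxiliary level `U″` descends to level `U = Σ₀(pN⁺)` along
`G = U∕U″` in characteristic `0`, at any prime `p` (here `p = 3`). [cite: BertoliniDarmon2007, Thm. 2.5, §2.4, Rem. 2.6]
[cite: GreenbergStevens1993, Thm. 5.13, Prop. 6.1] -/
theorem invariants_descent (f : M →ₗ[A] M') (hf : ∀ g : G, f ∘ₗ ρ g = σ g ∘ₗ f)
    (hsurj : Function.Surjective f) (I : Ideal A) (hker : LinearMap.ker f = I • (⊤ : Submodule A M)) :
    ρ.invariants.map f = σ.invariants ∧ ρ.invariants ⊓ LinearMap.ker f = I • ρ.invariants :=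
  ⟨invariants_map_eq_of_surjective ρ σ f hf hsurj, invariants_inf_ker_eq_smul ρ f I hker⟩

omit [Fintype G] [Invertible (Fintype.card G : A)] in
/-- **The invariants are a direct summand** (`#G` invertible): the kernel of the averaging projector
is a complement. [cite: BertoliniDarmon2007, §2.4] -/
theorem exists_isCompl_invariants [Fintype G] [Invertible (Fintype.card G : A)] :
    ∃ N : Submodule A M, IsCompl ρ.invariants N :=
  ⟨_, ρ.isProj_averageMap.isCompl⟩

/-- **The invariants of a projective module are projective** (`#G` invertible; hence FREE of finite
rank over a principal ideal domain such as the affinoid algebra `A(𝒰)` of a closed disc, when `M` is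
free of finite rank) — split by the averaging projector. [cite: BertoliniDarmon2007, Thm. 2.5, §2.4] -/
theorem projective_invariants [Module.Projective A M] : Module.Projective A ρ.invariants :=
  Module.Projective.of_split ρ.invariants.subtype ρ.isProj_averageMap.codRestrict
    (LinearMap.ext fun x ↦ ρ.isProj_averageMap.codRestrict_apply_cod x)


/-! ### §2 Direct summands (memo §2.3 step S5: the eigen-direct-summand `N = A·φ_∞` of the free
module `M`, and more generally any complemented submodule, meets `I•M` in `I•N`, i.e. `N∕I·N ↪ M∕I·M`
— the non-vanishing of `ρ_k(φ_∞)` at EVERY point `k` of the weight disc) -/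

section DirectSummand

variable {B : Type*} [CommRing B] {V : Type*} [AddCommGroup V] [Module B V]

/-- **The range of an idempotent meets `I•V` in `I•(range)`**: for `e² = e` in `End_B(V)` and an ideal
`I`, `e(V) ∩ I·V = I·e(V)` — apply `e` to a presentation `x = ∑ aⱼ vⱼ`, `aⱼ ∈ I`. (Generalises
`invariants_inf_smul_top`, the case `e =` the averaging projector.) [cite: BertoliniDarmon2007, Thm. 2.5, §2.4] -/
theorem range_inf_smul_top_of_isIdempotentElem {e : V →ₗ[B] V} (he : IsIdempotentElem e)
    (I : Ideal B) : LinearMap.range e ⊓ (I • ⊤ : Submodule B V) = I • LinearMap.range e := by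
  refine le_antisymm ?_ (le_inf Submodule.smul_le_right (Submodule.smul_mono le_rfl le_top))
  rintro x ⟨⟨y, rfl⟩, hxI⟩
  have hfix : e (e y) = e y := by
    have h := congrArg (fun φ : V →ₗ[B] V ↦ φ y) he
    simpa only [Module.End.mul_apply] using h
  rw [← hfix]
  have hmem : e (e y) ∈ (I • (⊤ : Submodule B V)).map e := ⟨e y, hxI, rfl⟩
  rwa [Submodule.map_smul'', Submodule.map_top] at hmem

/-- **A complemented submodule meets `I•V` in `I•N`**: if `N ⊕ N′ = V` then `N ∩ I·V = I·N` for every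
ideal `I`, i.e. the natural map `N∕I·N → V∕I·V` is INJECTIVE. In the audit (memo §2.3 S5): `N = A·φ_∞`,
the saturated Hecke-eigen-submodule of the free module `M` of ordinary `A(𝒰)`-adic quaternionic forms
over the PID `A(𝒰)`, is a direct summand, so `φ_∞ ∉ I_k·M`, i.e. `ρ_k(φ_∞) ≠ 0`, at every weight `k`
of the disc. [cite: BertoliniDarmon2007, Thm. 2.5 (2), §2.4] -/
theorem inf_smul_top_eq_smul_of_isCompl {N N' : Submodule B V} (h : IsCompl N N') (I : Ideal B) :
    N ⊓ (I • ⊤ : Submodule B V) = I • N := by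
  have key := range_inf_smul_top_of_isIdempotentElem (Submodule.isIdempotentElem_projection h) I
  rwa [Submodule.range_projection] at key

/-- **Pointwise form**: under `N ⊕ N′ = V`, an element of `N` lying in `I·V` lies in `I·N`.
[cite: BertoliniDarmon2007, Thm. 2.5 (2), §2.4] -/
theorem mem_smul_of_mem_of_mem_smul_top {N N' : Submodule B V} (h : IsCompl N N') (I : Ideal B)
    {x : V} (hxN : x ∈ N) (hxI : x ∈ (I • ⊤ : Submodule B V)) : x ∈ I • N := by
  rw [← inf_smul_top_eq_smul_of_isCompl h I]
  exact ⟨hxN, hxI⟩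

end DirectSummand


/-! ### §3 (B2 sheet `HOME/mult-p4/B2-HIDA-AT-3.md` (c3)) The commutator subgroup of `GL₂(𝔽₃)` fixes no
line of `𝔽₃²` — so for `ρ̄_{E,3}` ONTO `GL₂(𝔽₃)` (`Surj W 3`) the restriction to any normal subgroup of
`Gal(ℚ̄∕ℚ)` with abelian quotient (e.g. `Gal(ℚ̄∕ℚ(μ_M))`) is still irreducible, which is what separates the
maximal ideal of `ρ̄_{E,3}` from the (Eisenstein) boundary cohomology in the «T^± vs H¹(Y₁)» bookkeeping. -/

section GLTwoFThree

open Matrix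

/-- **Two commutators of `GL₂(𝔽₃)` without a common eigenvector**: with `g = diag(2,1)`, `u = (1 1; 0 1)`,
`l = (1 0; 1 1)` one has `[g,u] = u`, `[g,l] = l`, and no non-zero `v ∈ 𝔽₃²` is an eigenvector of both (a
finite check, `decide`). [cite: SerreInventiones1972, §2 Prop. 15] -/
theorem glTwoFThree_exists_commutators_without_common_eigenvector :
    ∃ g u l : GL (Fin 2) (ZMod 3), ∀ v : Fin 2 → ZMod 3, v ≠ 0 →
      (∀ c : ZMod 3,
          ((g * u * g⁻¹ * u⁻¹ : GL (Fin 2) (ZMod 3)) : Matrix (Fin 2) (Fin 2) (ZMod 3)) *ᵥ v ≠ c • v) ∨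
      (∀ c : ZMod 3,
          ((g * l * g⁻¹ * l⁻¹ : GL (Fin 2) (ZMod 3)) : Matrix (Fin 2) (Fin 2) (ZMod 3)) *ᵥ v ≠ c • v) :=
  ⟨⟨!![2, 0; 0, 1], !![2, 0; 0, 1], by decide, by decide⟩,
    ⟨!![1, 1; 0, 1], !![1, 2; 0, 1], by decide, by decide⟩,
    ⟨!![1, 0; 1, 1], !![1, 0; 2, 1], by decide, by decide⟩, by decide⟩

/-- **A subgroup of `GL₂(𝔽₃)` containing all commutators fixes no line**: for every non-zero `v ∈ 𝔽₃²`
some element of `H` moves the line `𝔽₃·v`. Applied with `H` = the image under a SURJECTIVE `ρ̄_{E,3}` of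
a normal subgroup of the Galois group with abelian quotient: the restriction of `ρ̄_{E,3}` to
`Gal(ℚ̄∕ℚ(μ_M))` is irreducible, hence (Brauer–Nesbitt) its traces are not those of `𝟙 ⊕ χ̄₃` — the
boundary∕Eisenstein separation of the B2 sheet, step (c3). [cite: SerreInventiones1972, §2 Prop. 15]
[cite: GreenbergStevens1993, Lemma 6.10] -/
theorem glTwoFThree_exists_mem_moves_line_of_commutators_mem (H : Subgroup (GL (Fin 2) (ZMod 3)))
    (hH : ∀ g h : GL (Fin 2) (ZMod 3), g * h * g⁻¹ * h⁻¹ ∈ H) (v : Fin 2 → ZMod 3) (hv : v ≠ 0) :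
    ∃ x ∈ H, ∀ c : ZMod 3, (x : Matrix (Fin 2) (Fin 2) (ZMod 3)) *ᵥ v ≠ c • v := by
  obtain ⟨g, u, l, h⟩ := glTwoFThree_exists_commutators_without_common_eigenvector
  rcases h v hv with h1 | h2
  · exact ⟨_, hH g u, h1⟩
  · exact ⟨_, hH g l, h2⟩

end GLTwoFThree

end Summit.BirchSwinnertonDyer.BirchSwinnertonDyer.Theorems.ExceptionalZeroRoad.Descent
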